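import Mathlib.Analysis.Convex.SimplicialComplex.Basic
import Mathlib.Analysis.InnerProductSpace.PiL2
import Mathlib.Geometry.Manifold.Instances.Real
import Mathlib.Geometry.Manifold.MFDeriv.Basic
import Mathlib.Geometry.Manifold.Diffeomorph
import Mathlib.LinearAlgebra.AffineSpace.AffineSubspace.Basic
import HarnessLib

/-!
# Whitehead smooth triangulations of a smooth manifold by a finite Euclidean simplicial complex

Topic `Literature/Topology/FourManifolds` (definition item `IsSmoothTriangulation`, route
`SmoothPoincare4/AngleDefectCertificates`, whose items repeat the clause below inline).

J. H. C. Whitehead, *On `C¹`-complexes*, Ann. of Math. 41 (1940), §1, and J. R. Munkres,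
*Elementary Differential Topology* (rev. ed. 1966), Def. 8.3: a **smooth (`C^∞`) triangulation** of
a smooth `n`-manifold `M` is a homeomorphism `h : |K| → M` from (the polyhedron of) a Euclidean
simplicial complex `K` such that for every simplex `s` of `K` the restriction of `h` to `s` extends
to a smooth map of a neighbourhood of `s` in the ambient Euclidean space (equivalently, of the plane
of `s`) whose differential is injective on the plane of `s` at every point of `s` — "`h|s` is a
smooth non-degenerate embedding of each closed simplex".

## The definition

`IsSmoothTriangulation n K h`, for a Euclidean geometric simplicial complex
`K : Geometry.SimplicialComplex ℝ (EuclideanSpace ℝ (Fin N))` (Mathlib), a homeomorphism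
`h : K.space ≃ₜ M` onto a `C^∞` manifold `M` modelled on `EuclideanSpace ℝ (Fin n)`:
`K` has finitely many faces (compact `M`; the routes' setting), and for every face `s` there are
an open `u ⊇ convexHull s` and `g : E^N → M`, `C^∞` on `u` (`ContMDiffOn 𝓘(ℝ, E^N) (𝓡 n) ∞ g u`),
agreeing with `h` on `convexHull s`, whose manifold derivative `mfderiv … g x` is injective on the
direction space `vectorSpan ℝ s` of the simplex at every `x ∈ convexHull s`. This is VERBATIM the
clause inlined in the route items (with `4 ↦ n`), so those restate by `Iff.rfl`.

## API (proved)

`isSmoothTriangulation_iff` (unfolding), `.finite`, `.exists_smooth_extension`, and transport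
along a diffeomorphism of the target, `IsSmoothTriangulation.trans_diffeomorph`
(`h ↦ e ∘ h`, `g ↦ e ∘ g`; the derivative of `e` is a linear isomorphism).

## Not here (named-fact / theorem territory, deliberately not minted)

Whitehead's theorems: a smooth triangulation is a combinatorial manifold (links are PL spheres);
it induces a PL structure Whitehead-compatible with the smooth one
(`Literature.IsWhiteheadCompatible`, `exists_isPLManifold_isWhiteheadCompatible` in
`PLManifold.lean`); existence for compact `M` (Whitehead 1940, Munkres Thm. 10.6) and uniqueness up
to PL homeomorphism. Purity / dimension of `K` is not part of the predicate (the routes add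
"every face lies in a face with `n + 1` vertices" separately).

## References

* J. H. C. Whitehead, *On `C¹`-complexes*, Ann. of Math. (2) 41 (1940), 809–824, §1.
* J. R. Munkres, *Elementary Differential Topology*, Ann. of Math. Studies 54 (rev. ed. 1966),
  Def. 8.3, Thm. 10.6.
-/

noncomputable section

open scoped Manifold ContDiff
open Set

namespace Literature.Topology.FourManifolds

variable {n N : ℕ} {M : Type*} [TopologicalSpace M] [ChartedSpace (EuclideanSpace ℝ (Fin n)) M]

variable (n) in
/-- **Whitehead smooth triangulation** of the `C^∞` `n`-manifold `M` by the finite Euclidean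
simplicial complex `K ⊆ E^N` along the homeomorphism `h : |K| ≃ₜ M`: finitely many faces, and on
each closed simplex `h` extends to a `C^∞` map of an open neighbourhood in `E^N` whose derivative
is injective on the plane of the simplex (Whitehead 1940 §1; Munkres 1966 Def. 8.3). Verbatim the
clause used inline by route `SmoothPoincare4/AngleDefectCertificates`. [cite: Munkres1966, Def. 8.3] -/
def IsSmoothTriangulation (K : Geometry.SimplicialComplex ℝ (EuclideanSpace ℝ (Fin N)))
    (h : K.space ≃ₜ M) : Prop :=
  K.faces.Finite ∧
    ∀ s ∈ K.faces, ∃ (g : EuclideanSpace ℝ (Fin N) → M) (u : Set (EuclideanSpace ℝ (Fin N))),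
      IsOpen u ∧ convexHull ℝ (s : Set (EuclideanSpace ℝ (Fin N))) ⊆ u ∧
      ContMDiffOn 𝓘(ℝ, EuclideanSpace ℝ (Fin N)) (𝓡 n) ∞ g u ∧
      (∀ y : K.space, (y : EuclideanSpace ℝ (Fin N)) ∈ convexHull ℝ (s : Set (EuclideanSpace ℝ (Fin N))) →
        h y = g y) ∧
      ∀ x ∈ convexHull ℝ (s : Set (EuclideanSpace ℝ (Fin N))),
        Set.InjOn (mfderiv 𝓘(ℝ, EuclideanSpace ℝ (Fin N)) (𝓡 n) g x)
          (vectorSpan ℝ (s : Set (EuclideanSpace ℝ (Fin N))) : Set (EuclideanSpace ℝ (Fin N)))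

/-- Unfolding of `IsSmoothTriangulation` (it is literally the routes' inline clause). [folklore] -/
theorem isSmoothTriangulation_iff (K : Geometry.SimplicialComplex ℝ (EuclideanSpace ℝ (Fin N)))
    (h : K.space ≃ₜ M) :
    IsSmoothTriangulation n K h ↔
      K.faces.Finite ∧
        ∀ s ∈ K.faces, ∃ (g : EuclideanSpace ℝ (Fin N) → M) (u : Set (EuclideanSpace ℝ (Fin N))),
          IsOpen u ∧ convexHull ℝ (s : Set (EuclideanSpace ℝ (Fin N))) ⊆ u ∧
          ContMDiffOn 𝓘(ℝ, EuclideanSpace ℝ (Fin N)) (𝓡 n) ∞ g u ∧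
          (∀ y : K.space, (y : EuclideanSpace ℝ (Fin N)) ∈ convexHull ℝ (s : Set (EuclideanSpace ℝ (Fin N))) →
            h y = g y) ∧
          ∀ x ∈ convexHull ℝ (s : Set (EuclideanSpace ℝ (Fin N))),
            Set.InjOn (mfderiv 𝓘(ℝ, EuclideanSpace ℝ (Fin N)) (𝓡 n) g x)
              (vectorSpan ℝ (s : Set (EuclideanSpace ℝ (Fin N))) : Set (EuclideanSpace ℝ (Fin N))) :=
  Iff.rfl

namespace IsSmoothTriangulation

variable {K : Geometry.SimplicialComplex ℝ (EuclideanSpace ℝ (Fin N))} {h : K.space ≃ₜ M}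

/-- A smooth triangulation (in the routes' sense) has finitely many simplices. [cite: Munkres1966, Def. 8.3] -/
theorem finite (hK : IsSmoothTriangulation n K h) : K.faces.Finite := hK.1

/-- On each closed simplex, `h` extends to a `C^∞` map of an ambient neighbourhood with derivative
injective on the plane of the simplex. [cite: Munkres1966, Def. 8.3] -/
theorem exists_smooth_extension (hK : IsSmoothTriangulation n K h) {s : Finset (EuclideanSpace ℝ (Fin N))}
    (hs : s ∈ K.faces) :
    ∃ (g : EuclideanSpace ℝ (Fin N) → M) (u : Set (EuclideanSpace ℝ (Fin N))),
      IsOpen u ∧ convexHull ℝ (s : Set (EuclideanSpace ℝ (Fin N))) ⊆ u ∧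
      ContMDiffOn 𝓘(ℝ, EuclideanSpace ℝ (Fin N)) (𝓡 n) ∞ g u ∧
      (∀ y : K.space, (y : EuclideanSpace ℝ (Fin N)) ∈ convexHull ℝ (s : Set (EuclideanSpace ℝ (Fin N))) →
        h y = g y) ∧
      ∀ x ∈ convexHull ℝ (s : Set (EuclideanSpace ℝ (Fin N))),
        Set.InjOn (mfderiv 𝓘(ℝ, EuclideanSpace ℝ (Fin N)) (𝓡 n) g x)
          (vectorSpan ℝ (s : Set (EuclideanSpace ℝ (Fin N))) : Set (EuclideanSpace ℝ (Fin N))) :=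
  hK.2 s hs

/-- **Transport along a diffeomorphism of the target**: if `h : |K| → M` is a smooth triangulation
and `e : M → M'` a `C^∞` diffeomorphism, then `e ∘ h : |K| → M'` is a smooth triangulation (compose
the local extensions with `e`; `mfderiv e` is a linear isomorphism). [cite: Munkres1966, Def. 8.3] -/
theorem trans_diffeomorph {M' : Type*} [TopologicalSpace M'] [ChartedSpace (EuclideanSpace ℝ (Fin n)) M']
    [IsManifold (𝓡 n) ∞ M] [IsManifold (𝓡 n) ∞ M']
    (hK : IsSmoothTriangulation n K h) (e : Diffeomorph (𝓡 n) (𝓡 n) M M' ∞) :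
    IsSmoothTriangulation n K (h.trans e.toHomeomorph) := by
  refine ⟨hK.1, fun s hs => ?_⟩
  obtain ⟨g, u, hu, hsu, hg, hhg, hinj⟩ := hK.2 s hs
  refine ⟨e ∘ g, u, hu, hsu, e.contMDiff.comp_contMDiffOn hg, fun y hy => ?_, fun x hx => ?_⟩
  · simp only [Homeomorph.trans_apply, Diffeomorph.coe_toHomeomorph, Function.comp_apply, hhg y hy]
  · have hgx : MDifferentiableAt 𝓘(ℝ, EuclideanSpace ℝ (Fin N)) (𝓡 n) g x :=
      ((hg.mdifferentiableOn (by simp)) x (hsu hx)).mdifferentiableAt (hu.mem_nhds (hsu hx))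
    have hex : MDifferentiableAt (𝓡 n) (𝓡 n) e (g x) := (e.contMDiff.mdifferentiable (by simp)) (g x)
    rw [mfderiv_comp x hex hgx]
    intro v hv w hw hvw
    apply hinj x hx hv hw
    have hinjE : Function.Injective (mfderiv (𝓡 n) (𝓡 n) e (g x)) :=
      (e.mfderivToContinuousLinearEquiv (by simp) (g x)).injective
    exact hinjE hvw

end IsSmoothTriangulation

end Literature.Topology.FourManifolds
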